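import Summits.CriticalPhenomena.PercolationContinuityZ3.Theorems.PercNearOneGluingNoHeavyLowerTailCILSmall
import Literature.Probability.LatticeModels.ProdBernoulliIndependence
import HarnessLib

/-!
# `NoHeavyLowerTail` (stmt-CriticalPhenomena-4575) — tools for the cut-observer cumulative isolation lemma

Support file (prover `prim-gen-induct`, strategy "induction on the blob quotient"; `--supports
stmt-CriticalPhenomena-4575`).  No definitions, no named facts, no sorries.  Everything here is
bookkeeping for `Theorems.cumulativeIsolation_cutObserver` (file `…CILCutObserver`):

* `CutObserver.prod_sub_prod_le` — the telescoping inequality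
  `∏_l (1 − c_l + c_l s_l) − ∏_l (1 − c_l) ≤ s · (1 − ∏_l (1 − c_l))` for `c_l ∈ [0,1]`,
  `0 ≤ s_l ≤ s ≤ 1` (the root step of the blob-quotient recursion in scalar form);
* `CutObserver.reachable_restrict_of_closed` — an open path starting in a vertex set that no open edge
  leaves is an open path of the configuration restricted to the edges inside that set;
* `CutObserver.measureReal_inter_support` — the event "every open edge has nonzero weight" has full
  `prodBernoulli w`-measure; one-edge probabilities `measureReal_open/closed`;
* `DeterminedBy` bookkeeping for the one-edge events, the branch-mass event
  `{|C_{V}(q) ∩ A| ≤ j}` (edges inside `V`) and the "open port ⇒ light branch" event, with the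
  factorisation `measureReal_noHeavy : μ{e open → M ≤ j} = (1 − w e) + w e · μ{M ≤ j}`;
* the cut-observer geometry on the support event (`branch_closed`, `piCard_eq_branchMass`,
  `bad_offPort_subset`) and the pairwise disjointness of the branch supports
  `insert (o–p l) (V l).sym2` (`supports_disjoint`).
-/

noncomputable section

namespace Summit.CriticalPhenomena.PercolationContinuityZ3.Theorems

open MeasureTheory Set Literature.Probability.LatticeModels Literature.Probability.Percolation
open scoped Classical BigOperators

variable {n : ℕ}

namespace CutObserver

/-! ### Real-arithmetic and graph tools -/

/-- **Telescoping inequality.**  For `c_l ∈ [0,1]`, `0 ≤ s_l ≤ s ≤ 1`: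
`∏_l (1 − c_l + c_l s_l) − ∏_l (1 − c_l) ≤ s · (1 − ∏_l (1 − c_l))`. [folklore] -/
theorem prod_sub_prod_le {ι : Type*} (T : Finset ι) (c s : ι → ℝ) (smax : ℝ)
    (hc0 : ∀ l ∈ T, 0 ≤ c l) (hc1 : ∀ l ∈ T, c l ≤ 1) (hs0 : ∀ l ∈ T, 0 ≤ s l)
    (hs : ∀ l ∈ T, s l ≤ smax) (hsmax : smax ≤ 1) :
    ∏ l ∈ T, (1 - c l + c l * s l) - ∏ l ∈ T, (1 - c l) ≤ smax * (1 - ∏ l ∈ T, (1 - c l)) := by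
  classical
  induction T using Finset.induction_on with
  | empty => simp
  | insert a T haT ih =>
    have hc0' : ∀ l ∈ T, 0 ≤ c l := fun l hl => hc0 l (Finset.mem_insert_of_mem hl)
    have hc1' : ∀ l ∈ T, c l ≤ 1 := fun l hl => hc1 l (Finset.mem_insert_of_mem hl)
    have hs0' : ∀ l ∈ T, 0 ≤ s l := fun l hl => hs0 l (Finset.mem_insert_of_mem hl)
    have hs' : ∀ l ∈ T, s l ≤ smax := fun l hl => hs l (Finset.mem_insert_of_mem hl)
    have ih' := ih hc0' hc1' hs0' hs'
    have ha0 : 0 ≤ c a := hc0 a (Finset.mem_insert_self _ _)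
    have ha1 : c a ≤ 1 := hc1 a (Finset.mem_insert_self _ _)
    have hsa0 : 0 ≤ s a := hs0 a (Finset.mem_insert_self _ _)
    have hsa : s a ≤ smax := hs a (Finset.mem_insert_self _ _)
    rw [Finset.prod_insert haT, Finset.prod_insert haT]
    set P1 := ∏ l ∈ T, (1 - c l + c l * s l) with hP1
    set P0 := ∏ l ∈ T, (1 - c l) with hP0
    have hP1le : P1 ≤ 1 := by
      rw [hP1]
      refine Finset.prod_le_one (fun l hl => ?_) (fun l hl => ?_)
      · nlinarith [hc0' l hl, hc1' l hl, hs0' l hl]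
      · nlinarith [hc0' l hl, hs' l hl, hsmax]
    have hP1ge : 0 ≤ P1 := by
      rw [hP1]
      exact Finset.prod_nonneg fun l hl => by nlinarith [hc0' l hl, hc1' l hl, hs0' l hl]
    have hP0ge : 0 ≤ P0 := by
      rw [hP0]; exact Finset.prod_nonneg fun l hl => by linarith [hc1' l hl]
    have hP0le : P0 ≤ 1 := by
      rw [hP0]; exact Finset.prod_le_one (fun l hl => by linarith [hc1' l hl]) fun l hl => by
        linarith [hc0' l hl]
    -- (1 - c a + c a s a) P1 - (1 - c a) P0 = (1 - c a)(P1 - P0) + c a s a P1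
    have h1 : (1 - c a) * (P1 - P0) ≤ (1 - c a) * (smax * (1 - P0)) :=
      mul_le_mul_of_nonneg_left ih' (by linarith)
    have h2 : c a * s a * P1 ≤ c a * smax := by
      have : s a * P1 ≤ smax := by nlinarith
      nlinarith
    nlinarith

/-- **Walks cannot leave a closed vertex set.**  If every open non-loop edge with one endpoint in `U` has
its other endpoint in `U`, then an open path starting in `U` is an open path of the configuration
restricted to the edges inside `U`. [folklore] -/
theorem reachable_restrict_of_closed {V : Type*} (ω : BondConfig V) (U : Set V)
    (hU : ∀ u ∈ U, ∀ v, s(u, v) ∈ ω → u ≠ v → v ∈ U) {x y : V} (hx : x ∈ U)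
    (h : (openGraph ω).Reachable x y) :
    (openGraph (ω ∩ {e | ∀ z ∈ e, z ∈ U})).Reachable x y := by
  obtain ⟨p⟩ := h
  induction p with
  | nil => exact SimpleGraph.Reachable.refl _
  | @cons u v w' hadj p ih =>
    have hadj' := hadj
    rw [openGraph, SimpleGraph.fromEdgeSet_adj] at hadj'
    have hv : v ∈ U := hU u hx v hadj'.1 hadj'.2
    have hstep : (openGraph (ω ∩ {e | ∀ z ∈ e, z ∈ U})).Adj u v := by
      rw [openGraph, SimpleGraph.fromEdgeSet_adj]
      refine ⟨⟨hadj'.1, ?_⟩, hadj'.2⟩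
      intro z hz
      rcases Sym2.mem_iff.1 hz with rfl | rfl
      · exact hx
      · exact hv
    exact hstep.reachable.trans (ih hv)

/-- Reachability is monotone in the configuration. [folklore] -/
theorem reachable_mono {V : Type*} {ω ω' : BondConfig V} (h : ω ⊆ ω') {x y : V}
    (hxy : (openGraph ω).Reachable x y) : (openGraph ω').Reachable x y :=
  hxy.mono (openGraph_mono h)

/-! ### Measure tools: the support event and one-edge events -/

/-- The event "every open edge has nonzero weight" has full measure: intersecting with it does not
change probabilities. [folklore] -/
theorem measureReal_inter_support (w : Sym2 (Fin n) → unitInterval) (E : Set (BondConfig (Fin n))) :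
    (prodBernoulli w).real (E ∩ {ω | ∀ e ∈ ω, w e ≠ 0}) = (prodBernoulli w).real E := by
  haveI : IsProbabilityMeasure (prodBernoulli w) := inferInstance
  have hnull : (prodBernoulli w).real {ω : BondConfig (Fin n) | ∀ e ∈ ω, w e ≠ 0}ᶜ = 0 := by
    have hsub : {ω : BondConfig (Fin n) | ∀ e ∈ ω, w e ≠ 0}ᶜ ⊆
        ⋃ e ∈ (Finset.univ.filter fun e : Sym2 (Fin n) => w e = 0),
          {ω : BondConfig (Fin n) | e ∈ ω} := by
      intro ω hω
      simp only [mem_compl_iff, mem_setOf_eq, not_forall, not_not, exists_prop] at hω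
      obtain ⟨e, he, hwe⟩ := hω
      exact mem_biUnion (Finset.mem_filter.2 ⟨Finset.mem_univ _, hwe⟩) he
    refine le_antisymm (le_trans (measureReal_mono hsub (measure_ne_top _ _)) ?_) measureReal_nonneg
    refine le_trans (measureReal_biUnion_finset_le _ _) (le_of_eq ?_)
    refine Finset.sum_eq_zero fun e he => ?_
    rw [prodBernoulli_real_setOf_mem]
    have := (Finset.mem_filter.1 he).2
    rw [this]; rfl
  have hsplit := measureReal_inter_add_sdiff₀ (μ := prodBernoulli w) (s := E)
    (MeasurableSet.of_discrete (s := {ω : BondConfig (Fin n) | ∀ e ∈ ω, w e ≠ 0})).nullMeasurableSet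
  have hdiff : (prodBernoulli w).real (E \ {ω : BondConfig (Fin n) | ∀ e ∈ ω, w e ≠ 0}) = 0 :=
    le_antisymm (le_trans (measureReal_mono fun ω hω => hω.2) (le_of_eq hnull)) measureReal_nonneg
  linarith

/-- `μ{e open} = w e`. [folklore] -/
theorem measureReal_open (w : Sym2 (Fin n) → unitInterval) (e : Sym2 (Fin n)) :
    (prodBernoulli w).real {ω : BondConfig (Fin n) | e ∈ ω} = w e :=
  prodBernoulli_real_setOf_mem w e

/-- `μ{e closed} = 1 − w e`. [folklore] -/
theorem measureReal_closed (w : Sym2 (Fin n) → unitInterval) (e : Sym2 (Fin n)) :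
    (prodBernoulli w).real {ω : BondConfig (Fin n) | e ∉ ω} = 1 - w e := by
  have := prodBernoulli_real_forall_notMem w ({e} : Finset (Sym2 (Fin n)))
  simpa using this


/-! ### Events of the root recursion and their supports -/

/-- The edge set inside a vertex set `U`, as a set of pairs: the coercion of `U.sym2`. [folklore] -/
theorem coe_sym2_eq (U : Finset (Fin n)) :
    (↑(U.sym2) : Set (Sym2 (Fin n))) = {e | ∀ z ∈ e, z ∈ U} := by
  ext e; simp only [Finset.mem_coe, Finset.mem_sym2_iff, mem_setOf_eq]

/-- The one-edge event `{e open}` is determined by `{e}`. [folklore] -/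
theorem determinedBy_open (e : Sym2 (Fin n)) :
    DeterminedBy {ω : BondConfig (Fin n) | e ∈ ω} (↑({e} : Finset (Sym2 (Fin n))) : Set _) := by
  rw [determinedBy_iff]
  intro ω ω' h
  have := Set.ext_iff.1 h e
  simp only [Finset.coe_singleton, mem_inter_iff, mem_singleton_iff, and_true] at this
  exact this

/-- The one-edge event `{e closed}` is determined by `{e}`. [folklore] -/
theorem determinedBy_closed (e : Sym2 (Fin n)) :
    DeterminedBy {ω : BondConfig (Fin n) | e ∉ ω} (↑({e} : Finset (Sym2 (Fin n))) : Set _) := by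
  rw [determinedBy_iff]
  intro ω ω' h
  have := Set.ext_iff.1 h e
  simp only [Finset.coe_singleton, mem_inter_iff, mem_singleton_iff, and_true] at this
  simp only [mem_setOf_eq]
  exact not_congr this

/-- The branch mass event `{M ≤ j}` (`M` = number of relays reachable from the port inside the branch
`U`) is determined by the edges inside `U`. [folklore] -/
theorem determinedBy_branchMass (A U : Finset (Fin n)) (q : Fin n) (j : ℕ) :
    DeterminedBy {ω : BondConfig (Fin n) |
        (A.filter fun x => (openGraph (ω ∩ ↑(U.sym2))).Reachable q x).card ≤ j}
      (↑(U.sym2) : Set (Sym2 (Fin n))) := by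
  rw [determinedBy_iff]
  intro ω ω' h
  simp only [mem_setOf_eq]
  rw [h]

/-- The "no heavy open branch" event `{e open → M ≤ j}` is determined by `insert e U.sym2`. [folklore] -/
theorem determinedBy_noHeavy (A U : Finset (Fin n)) (q : Fin n) (j : ℕ) (e : Sym2 (Fin n)) :
    DeterminedBy {ω : BondConfig (Fin n) | e ∈ ω →
        (A.filter fun x => (openGraph (ω ∩ ↑(U.sym2))).Reachable q x).card ≤ j}
      (↑(insert e U.sym2) : Set (Sym2 (Fin n))) := by
  rw [determinedBy_iff]
  intro ω ω' h
  have he : e ∈ ω ↔ e ∈ ω' := by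
    have := Set.ext_iff.1 h e
    simp only [Finset.coe_insert, mem_inter_iff, mem_insert_iff, true_or, and_true] at this
    exact this
  have hU : ω ∩ ↑(U.sym2) = ω' ∩ ↑(U.sym2) := by
    ext f
    have := Set.ext_iff.1 h f
    simp only [Finset.coe_insert, mem_inter_iff, mem_insert_iff, Finset.mem_coe] at this ⊢
    constructor
    · rintro ⟨hf, hfU⟩; exact ⟨(this.1 ⟨hf, Or.inr hfU⟩).1, hfU⟩
    · rintro ⟨hf, hfU⟩; exact ⟨(this.2 ⟨hf, Or.inr hfU⟩).1, hfU⟩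
  simp only [mem_setOf_eq]
  rw [he, hU]

/-- `μ{e open → M ≤ j} = (1 − w e) + w e · μ{M ≤ j}` when `e` is not an edge inside `U`. [folklore] -/
theorem measureReal_noHeavy (w : Sym2 (Fin n) → unitInterval) (A U : Finset (Fin n)) (q : Fin n)
    (j : ℕ) (e : Sym2 (Fin n)) (he : e ∉ U.sym2) :
    (prodBernoulli w).real {ω : BondConfig (Fin n) | e ∈ ω →
        (A.filter fun x => (openGraph (ω ∩ ↑(U.sym2))).Reachable q x).card ≤ j} =
      (1 - w e) + w e * (prodBernoulli w).real {ω : BondConfig (Fin n) |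
        (A.filter fun x => (openGraph (ω ∩ ↑(U.sym2))).Reachable q x).card ≤ j} := by
  haveI : IsProbabilityMeasure (prodBernoulli w) := inferInstance
  set Sm := {ω : BondConfig (Fin n) |
    (A.filter fun x => (openGraph (ω ∩ ↑(U.sym2))).Reachable q x).card ≤ j} with hSm
  have hsplit : {ω : BondConfig (Fin n) | e ∈ ω → ω ∈ Sm} =
      {ω : BondConfig (Fin n) | e ∉ ω} ∪ ({ω : BondConfig (Fin n) | e ∈ ω} ∩ Sm) := by
    ext ω
    simp only [mem_setOf_eq, mem_union, mem_inter_iff]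
    tauto
  have hdisj : Disjoint {ω : BondConfig (Fin n) | e ∉ ω} ({ω : BondConfig (Fin n) | e ∈ ω} ∩ Sm) := by
    rw [Set.disjoint_left]
    rintro ω hω ⟨hω', _⟩
    exact hω hω'
  have hind : (prodBernoulli w).real ({ω : BondConfig (Fin n) | e ∈ ω} ∩ Sm) =
      (prodBernoulli w).real {ω : BondConfig (Fin n) | e ∈ ω} * (prodBernoulli w).real Sm :=
    prodBernoulli_real_inter_of_determinedBy_disjoint w
      (Finset.disjoint_singleton_left.2 he) (determinedBy_open e)
      (by rw [hSm]; exact determinedBy_branchMass A U q j)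
      MeasurableSet.of_discrete MeasurableSet.of_discrete
  change (prodBernoulli w).real {ω : BondConfig (Fin n) | e ∈ ω → ω ∈ Sm} = _
  rw [hsplit, measureReal_union hdisj MeasurableSet.of_discrete, hind, measureReal_closed,
    measureReal_open]

/-! ### The cut-observer geometry: pointwise facts on the support event -/

section Geometry

variable (w : Sym2 (Fin n) → unitInterval) (A : Finset (Fin n)) (o : Fin n) {d : ℕ}
  (V : Fin d → Finset (Fin n)) (p : Fin d → Fin n)

/-- **Branches are closed off their port edge.**  On the support event, if the port edge `o–p i` is
closed then every open non-loop edge with an endpoint in `V i` lies inside `V i`. [folklore] -/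
theorem branch_closed (hpV : ∀ l, p l ∈ V l) (hoV : ∀ l, o ∉ V l)
    (hdisj : ∀ l l', l ≠ l' → Disjoint (V l) (V l'))
    (hcover : ∀ v, v ≠ o → ∃ l, v ∈ V l)
    (hobs : ∀ v, v ≠ o → (∀ l, v ≠ p l) → w s(o, v) = 0)
    (hsep : ∀ l l', l ≠ l' → ∀ u ∈ V l, ∀ v ∈ V l', w s(u, v) = 0)
    (i : Fin d) (ω : BondConfig (Fin n)) (hG : ∀ e ∈ ω, w e ≠ 0) (hXi : s(o, p i) ∉ ω) :
    ∀ u ∈ (↑(V i) : Set (Fin n)), ∀ v, s(u, v) ∈ ω → u ≠ v → v ∈ (↑(V i) : Set (Fin n)) := by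
  intro u hu v huv hne
  rw [Finset.mem_coe] at hu ⊢
  by_cases hvo : v = o
  · rw [hvo] at huv
    exfalso
    have huo : u ≠ o := fun h => hoV i (h ▸ hu)
    by_cases hport : ∀ l, u ≠ p l
    · exact hG _ huv (by rw [Sym2.eq_swap]; exact hobs u huo hport)
    · push Not at hport
      obtain ⟨l, rfl⟩ := hport
      have hli : l = i := by
        by_contra hli
        exact Finset.disjoint_left.1 (hdisj l i hli) (hpV l) hu
      subst hli
      exact hXi (by rw [Sym2.eq_swap]; exact huv)
  · obtain ⟨l, hl⟩ := hcover v hvo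
    by_cases hli : l = i
    · exact hli ▸ hl
    · exfalso
      exact hG _ huv (hsep i l (Ne.symm hli) u hu v hl)

/-- **Off its port edge, the port's cluster is its branch cluster**: on the support event with `o–p i`
closed, the relays joined to `p i` are exactly the relays joined to `p i` inside `V i`. [folklore] -/
theorem piCard_eq_branchMass (hpV : ∀ l, p l ∈ V l) (hoV : ∀ l, o ∉ V l)
    (hdisj : ∀ l l', l ≠ l' → Disjoint (V l) (V l'))
    (hcover : ∀ v, v ≠ o → ∃ l, v ∈ V l)
    (hobs : ∀ v, v ≠ o → (∀ l, v ≠ p l) → w s(o, v) = 0)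
    (hsep : ∀ l l', l ≠ l' → ∀ u ∈ V l, ∀ v ∈ V l', w s(u, v) = 0)
    (i : Fin d) (ω : BondConfig (Fin n)) (hG : ∀ e ∈ ω, w e ≠ 0) (hXi : s(o, p i) ∉ ω) :
    (A.filter fun x => ω ∈ openConn (p i) x).card =
      (A.filter fun x => (openGraph (ω ∩ ↑((V i).sym2))).Reachable (p i) x).card := by
  congr 1
  refine Finset.filter_congr fun x _ => ⟨fun h => ?_, fun h => ?_⟩
  · have hcl := branch_closed w o V p hpV hoV hdisj hcover hobs hsep i ω hG hXi
    have := reachable_restrict_of_closed ω (↑(V i)) hcl (Finset.mem_coe.2 (hpV i)) h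
    rwa [coe_sym2_eq]
  · exact reachable_mono inter_subset_left h

/-- **The minority event off the port edge forces a light open branch elsewhere**: on the support
event with `o–p i` closed, `1 ≤ N ≤ j` implies that every open port edge `o–p l` (`l ≠ i`) leads to a
branch of mass `≤ j`, and that some port edge `o–p l`, `l ≠ i`, is open. [folklore] -/
theorem bad_offPort_subset (hoA : o ∉ A) (hpV : ∀ l, p l ∈ V l) (hoV : ∀ l, o ∉ V l)
    (hobs : ∀ v, v ≠ o → (∀ l, v ≠ p l) → w s(o, v) = 0)
    (i : Fin d) (j : ℕ) (ω : BondConfig (Fin n)) (hG : ∀ e ∈ ω, w e ≠ 0) (hXi : s(o, p i) ∉ ω)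
    (h1 : 1 ≤ (A.filter fun x => ω ∈ openConn o x).card)
    (hj : (A.filter fun x => ω ∈ openConn o x).card ≤ j) :
    (∀ l ∈ Finset.univ.erase i, s(o, p l) ∈ ω →
        (A.filter fun x => (openGraph (ω ∩ ↑((V l).sym2))).Reachable (p l) x).card ≤ j) ∧
      ¬ (∀ l ∈ Finset.univ.erase i, s(o, p l) ∉ ω) := by
  constructor
  · intro l _ hopen
    refine le_trans (Finset.card_le_card fun x hx => ?_) hj
    rw [Finset.mem_filter] at hx ⊢
    refine ⟨hx.1, ?_⟩
    have hol : (openGraph ω).Adj o (p l) := by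
      rw [openGraph, SimpleGraph.fromEdgeSet_adj]
      exact ⟨hopen, fun h => hoV l (h ▸ hpV l)⟩
    exact hol.reachable.trans (reachable_mono inter_subset_left hx.2)
  · intro hall
    obtain ⟨x, hx⟩ := Finset.card_pos.1 (by omega : 0 < (A.filter fun x => ω ∈ openConn o x).card)
    rw [Finset.mem_filter] at hx
    have hxo : x ≠ o := fun h => hoA (h ▸ hx.1)
    have hreach : (openGraph ω).Reachable o x := hx.2
    obtain ⟨wk⟩ := hreach
    cases wk with
    | nil => exact hxo rfl
    | @cons _ v _ hadj _ =>
      rw [openGraph, SimpleGraph.fromEdgeSet_adj] at hadj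
      have hvo : v ≠ o := fun h => hadj.2 h.symm
      by_cases hport : ∀ l, v ≠ p l
      · exact hG _ hadj.1 (hobs v hvo hport)
      · push Not at hport
        obtain ⟨l, rfl⟩ := hport
        by_cases hli : l = i
        · subst hli; exact hXi hadj.1
        · exact hall l (Finset.mem_erase.2 ⟨hli, Finset.mem_univ _⟩) hadj.1

end Geometry


/-! ### Supports of the branch events are pairwise disjoint -/

section Supports

variable (o : Fin n) {d : ℕ} (V : Fin d → Finset (Fin n)) (p : Fin d → Fin n)

/-- The port edge `o–p k` is not in the support `insert (o–p k') (V k').sym2` of another branch. [folklore] -/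
theorem portEdge_not_mem (hpV : ∀ l, p l ∈ V l) (hoV : ∀ l, o ∉ V l)
    (hdisj : ∀ l l', l ≠ l' → Disjoint (V l) (V l')) {k k' : Fin d} (hkk' : k ≠ k') :
    s(o, p k) ∉ insert s(o, p k') (V k').sym2 := by
  rw [Finset.mem_insert, not_or]
  constructor
  · intro h
    rw [Sym2.congr_right] at h
    exact Finset.disjoint_left.1 (hdisj k k' hkk') (hpV k) (h ▸ hpV k')
  · intro h
    rw [Finset.mem_sym2_iff] at h
    exact hoV k' (h o (Sym2.mem_mk_left _ _))

/-- The port edge `o–p k` is not an edge inside the branch `V k`. [folklore] -/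
theorem portEdge_not_mem_sym2 (hoV : ∀ l, o ∉ V l) (k : Fin d) : s(o, p k) ∉ (V k).sym2 := by
  intro h
  rw [Finset.mem_sym2_iff] at h
  exact hoV k (h o (Sym2.mem_mk_left _ _))

/-- The supports `insert (o–p k) (V k).sym2` of distinct branches are disjoint. [folklore] -/
theorem supports_disjoint (hpV : ∀ l, p l ∈ V l) (hoV : ∀ l, o ∉ V l)
    (hdisj : ∀ l l', l ≠ l' → Disjoint (V l) (V l')) {k k' : Fin d} (hkk' : k ≠ k') :
    Disjoint (insert s(o, p k) (V k).sym2) (insert s(o, p k') (V k').sym2) := by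
  rw [Finset.disjoint_left]
  intro e he he'
  rcases Finset.mem_insert.1 he with rfl | heV
  · exact portEdge_not_mem o V p hpV hoV hdisj hkk' he'
  · rcases Finset.mem_insert.1 he' with rfl | heV'
    · exact portEdge_not_mem o V p hpV hoV hdisj (Ne.symm hkk') he
    · rw [Finset.mem_sym2_iff] at heV heV'
      have hx : e.out.1 ∈ e := Sym2.out_fst_mem e
      exact Finset.disjoint_left.1 (hdisj k k' hkk') (heV _ hx) (heV' _ hx)

end Supports

end CutObserver

end Summit.CriticalPhenomena.PercolationContinuityZ3.Theorems

end
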